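import Literature.Analysis.FluidPDE.OkamotoSakajoWunsch2008.HilbertTransformAnalytic
import Literature.Analysis.Fourier.HilbertTransformCircleEndpoints
import Literature.Analysis.FluidPDE.OkamotoSakajoWunsch2008.AprioriBounds
import Summits.NavierStokesRegularity.OSWSelfSimilar.OSWAprioriWindowGrowth
import HarnessLib

/-!
# OSW separable blow-up, THEOREM E2 DISCHARGED: every analytic separable profile has `1/P < a < 1`

HONEST FRAMING (cells pub-oswblow / ns-blowup; 1-D MODEL (gCLM/OSW on the circle), computer-assisted context; not Euler/NS).

`OkamotoSakajoWunsch2008/AprioriBounds.lean` kernel-checks the ARITHMETIC step of the cell's LAW.md THEOREM E2 and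
`OSWAprioriAnalyticStep.lean` its ANALYTIC step as pure limits, leaving as hypotheses: the vanishing orders `m` at the origin and
`p` at the antipode (`x f′/f → m`, `y F′/F → p`), the continuity of `Hf`, the slope `g(x)/x → H₀`, and the kernel integrability of
`f·cot(·/2)`, `f·tan(·/2)`. For the TYPED TARGET of `SeparableBlowup.lean` — `AnalyticSeparableProfile P lo hi`: an exponentially
decaying, real, odd coefficient sequence `c`, negative profile on `(0, π)`, Fourier-side profile equation `IsSeparableProfile a c`,
antipodal order `HasAntipodalOrder c P` — ALL of these are discharged here, using `HilbertTransformAnalytic.lean` (the multiplier is the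
analytic operator, so (T1) holds for the real profile `f = Re ∘ fourierEval c` with `H = hilbertTransformCircle`):

* kernel integrability from the `C¹` bound `|f′| ≤ Σ_k ‖derivCoeff c k‖` and `f(0) = f(π) = 0` (Jordan's inequality), hence the
  signs `Hf(0) > 0 > Hf(π)` (`HilbertTransformCircleEndpoints.lean`);
* the vanishing-order limits EXIST by (T1) itself: `x f′(x)/f(x) = (Hf(x) − 1)/(a·g(x)/x) → (H₀ − 1)/(a H₀)` (and likewise at the
  antipode), which makes the two E2 identities tautologies (`a = 0` is excluded: it forces `Hf ≡ 1` on `(0, π)`, against `Hf(π) < 0`);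
* the CONTENT of E2 is then two growth lemmas of one-variable calculus (`F/y^q` is monotone where `y F′/F ≥ q`, antitone where
  `≤ q` — logarithmic derivative): a `C¹` function vanishing at `0` cannot vanish slower than linearly, so `m ≥ 1`
  (`one_le_of_tendsto_logDeriv`); and `F(y)/y^P → κ ≠ 0` pins `p = P` (`eq_natCast_of_tendsto_logDeriv`).

Main results (namespace `Summit.NavierStokesRegularity.OSWSelfSimilar.OSWAprioriWindow`): `apriori_window` — the witnessing parameter of
any analytic separable profile with antipodal order `P` satisfies `1/P < a < 1`, with the antipode identity `(1 − a·P)·Hf(π) = 1`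
(`antipode_identity`) as a by-product (a falsifiable prediction for every certified rung: `Hf(π) = −1/(aP − 1)`), and for a simple
zero at the origin the origin identity `(1 − a)·Hf(0) = 1` (`origin_identity_of_simple_zero`); corollaries
`two_le_antipodalOrder` (`P ≥ 2`), `analyticSeparableProfile_sharpen` (the target's parameter window may always be intersected with
`(1/P, 1)`), `not_analyticSeparableProfile_of_hi_le` / `_of_one_le_lo`. MODEL statements about a typed, unasserted target; no definition,
no named fact, nothing about existence of a profile.
-/

noncomputable section

namespace Summit.NavierStokesRegularity.OSWSelfSimilar
namespace OSWAprioriWindow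

open _root_.MeasureTheory _root_.Set _root_.Filter
open Literature.Analysis.Fourier Literature.Analysis.FluidPDE.OkamotoSakajoWunsch2008
open scoped Real Topology

/-! ### The typed target: notation-free facts about `f = Re ∘ fourierEval c` -/

/-- `‖Σ_k d_k e^{ikx}‖ ≤ Σ_k ‖d_k‖` for absolutely summable coefficients. [folklore] -/
theorem norm_fourierEval_le {d : ℤ → ℂ} (hd : Summable fun k => ‖d k‖) (x : ℝ) :
    ‖fourierEval d x‖ ≤ ∑' k, ‖d k‖ := by
  unfold fourierEval
  have h1 : ∀ k, ‖d k * expChar k x‖ = ‖d k‖ := fun k => by rw [norm_mul, norm_expChar, mul_one]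
  calc ‖∑' k, d k * expChar k x‖ ≤ ∑' k, ‖d k * expChar k x‖ := norm_tsum_le_tsum_norm (hd.congr fun k => (h1 k).symm)
    _ = ∑' k, ‖d k‖ := by simp_rw [h1]

/-- `e^{ik(x+2π)} = e^{ikx}` (helper). [folklore] -/
private theorem expChar_add_two_pi' (k : ℤ) (x : ℝ) : expChar k (x + 2 * π) = expChar k x := by
  unfold expChar
  have h : Complex.I * (k : ℂ) * ((x + 2 * π : ℝ) : ℂ) = Complex.I * (k : ℂ) * (x : ℂ) + (k : ℂ) * (2 * π * Complex.I) := by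
    push_cast
    ring
  rw [h, Complex.exp_add, Complex.exp_int_mul_two_pi_mul_I, mul_one]

/-- OSW's velocity series is `2π`-periodic (no summability needed). [folklore] -/
theorem velocityEval_add_two_pi (c : ℤ → ℂ) (x : ℝ) : velocityEval c (x + 2 * π) = velocityEval c x := by
  unfold velocityEval
  simp_rw [expChar_add_two_pi']

/-- **THEOREM E2, discharged.** Let `c` be an exponentially decaying, real, odd coefficient sequence whose profile
`f = Re ∘ fourierEval c` is negative on `(0, π)`, solves the Fourier-side separable-blow-up profile equation `IsSeparableProfile a c`
and has antipodal order `P` (`HasAntipodalOrder c P`) — i.e. the data of the typed target `AnalyticSeparableProfile`. Then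
`1/P < a < 1`, the antipode identity `(1 − a·P)·Hf(π) = 1` holds with `H = hilbertTransformCircle`, `P ≥ 2`, and — if the zero at
the origin is simple, `f′(0) ≠ 0` — the origin identity `(1 − a)·Hf(0) = 1`. [folklore] -/
theorem apriori_window_and_antipode_identity {a : ℝ} {c : ℤ → ℂ} {ρ K : ℝ} {P : ℕ} (hdec : ExpDecay c ρ K)
    (hre : IsRealSeq c) (hodd : IsOddSeq c) (hneg : ∀ x : ℝ, 0 < x → x < π → (fourierEval c x).re < 0)
    (hT1 : IsSeparableProfile a c) (hP : HasAntipodalOrder c P) :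
    (1 / (P : ℝ) < a ∧ a < 1) ∧
      (1 - a * P) * hilbertTransformCircle (fun y => (fourierEval c y).re) π = 1 ∧ 2 ≤ P ∧
      ((fourierEval (derivCoeff c) 0).re ≠ 0 → (1 - a) * hilbertTransformCircle (fun y => (fourierEval c y).re) 0 = 1) := by
  -- the real objects
  set f : ℝ → ℝ := fun x => (fourierEval c x).re with hf_def
  set f' : ℝ → ℝ := fun x => (fourierEval (derivCoeff c) x).re with hf'_def
  set g : ℝ → ℝ := fun x => (velocityEval c x).re with hg_def
  set Hc : ℝ → ℝ := fun x => (fourierEval (hilbertCoeff c) x).re with hHc_def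
  have hH : hilbertTransformCircle f = Hc := hilbertTransformCircle_fourierEval_re_eq hdec hre
  -- calculus facts
  have hfd : ∀ x, HasDerivAt f (f' x) x := fun x => hasDerivAt_fourierEval_re hdec x
  have hgd : ∀ x, HasDerivAt g (Hc x) x := by
    intro x
    have h := hasDerivAt_velocityEval_re hdec hre x
    rw [hilbertTransformCircle_fourierEval_re hdec hre x] at h
    exact h
  have hfc : Continuous f := Complex.continuous_re.comp (continuous_fourierEval hdec)
  have hHcc : Continuous Hc := Complex.continuous_re.comp (continuous_fourierEval (expDecay_hilbertCoeff hdec))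
  -- the equation with the analytic operator, rewritten on the coefficient side
  have hEq : ∀ x, f x = -a * g x * f' x + f x * Hc x := by
    intro x
    have h := profileEq_re_of_isSeparableProfile hdec hre hT1 x
    rw [hilbertTransformCircle_fourierEval_re hdec hre x] at h
    exact h
  -- symmetries
  have hfodd : ∀ x, f (-x) = -f x := fun x => by
    simp only [hf_def, fourierEval_neg_of_isOddSeq hodd, Complex.neg_re]
  have hfper : ∀ x, f (x + 2 * π) = f x := fun x => by simp only [hf_def, fourierEval_add_two_pi]
  have hgodd : ∀ x, g (-x) = -g x := fun x => by
    simp only [hg_def, velocityEval_neg_of_isOddSeq hodd, Complex.neg_re]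
  have hgper : ∀ x, g (x + 2 * π) = g x := fun x => by simp only [hg_def, velocityEval_add_two_pi]
  have hf0 : f 0 = 0 := by have h := hfodd 0; rw [neg_zero] at h; linarith
  have hg0 : g 0 = 0 := by have h := hgodd 0; rw [neg_zero] at h; linarith
  have hfπ : f π = 0 := by
    have h1 := hfper (-π); rw [show -π + 2 * π = π by ring, hfodd] at h1; linarith
  have hgπ : g π = 0 := by
    have h1 := hgper (-π); rw [show -π + 2 * π = π by ring, hgodd] at h1; linarith
  have hneg' : ∀ y ∈ Ioo (0 : ℝ) π, f y < 0 := fun y hy => hneg y hy.1 hy.2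
  -- Lipschitz bound from the derivative series
  set L : ℝ := ∑' k, ‖derivCoeff c k‖ with hL_def
  have hL : ∀ x, |f' x| ≤ L := fun x =>
    (Complex.abs_re_le_norm _).trans (norm_fourierEval_le (expDecay_derivCoeff hdec).summable_norm x)
  have hlip : ∀ x y : ℝ, |f y - f x| ≤ L * |y - x| := by
    intro x y
    have := Convex.norm_image_sub_le_of_norm_hasDerivWithin_le (f := f) (f' := f') (s := univ)
      (fun z _ => (hfd z).hasDerivWithinAt) (fun z _ => by rw [Real.norm_eq_abs]; exact hL z) convex_univ
      (mem_univ x) (mem_univ y)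
    simpa [Real.norm_eq_abs] using this
  have hb0 : ∀ y ∈ Icc (0 : ℝ) π, |f y| ≤ L * y := by
    intro y hy
    have := hlip 0 y
    rwa [hf0, sub_zero, sub_zero, abs_of_nonneg hy.1] at this
  have hbπ : ∀ y ∈ Icc (0 : ℝ) π, |f y| ≤ L * (π - y) := by
    intro y hy
    have := hlip π y
    rwa [hfπ, sub_zero, abs_sub_comm, abs_of_nonneg (by linarith [hy.2] : (0 : ℝ) ≤ π - y)] at this
  -- kernel signs
  have hH0 : 0 < Hc 0 := by
    rw [← hH]; exact hilbertTransformCircle_zero_pos hfodd hneg' (intervalIntegrable_mul_cot_half hfc hb0)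
  have hHπ : Hc π < 0 := by
    rw [← hH]; exact hilbertTransformCircle_pi_neg hfodd hfper hneg' (intervalIntegrable_mul_tan_half hfc hbπ)
  -- `a ≠ 0`: otherwise `Hc = 1` on `(0, π)`, hence at `π` by continuity
  have ha : a ≠ 0 := by
    intro ha0
    have h1 : ∀ y ∈ Ioo (0 : ℝ) π, Hc y = 1 := by
      intro y hy
      have e := hEq y
      rw [ha0] at e
      have hfy : f y ≠ 0 := (hneg' y hy).ne
      have : f y * (Hc y - 1) = 0 := by linear_combination -e
      rcases mul_eq_zero.mp this with h | h
      · exact absurd h hfy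
      · linarith
    have hlim : Tendsto Hc (𝓝[<] π) (𝓝 (Hc π)) := hHcc.continuousAt.tendsto.mono_left nhdsWithin_le_nhds
    have hev : ∀ᶠ y in 𝓝[<] π, Hc y = 1 := by
      filter_upwards [Ioo_mem_nhdsLT Real.pi_pos] with y hy using h1 y hy
    have h2 : Tendsto Hc (𝓝[<] π) (𝓝 1) := tendsto_const_nhds.congr' (hev.mono fun y hy => hy.symm)
    have := tendsto_nhds_unique hlim h2
    linarith
  -- ORIGIN: the order limit exists and is ≥ 1
  have hg_slope : Tendsto (fun x => g x / x) (𝓝[>] 0) (𝓝 (Hc 0)) := by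
    have h := (hgd 0).tendsto_slope_zero_right
    refine h.congr' ?_
    filter_upwards [self_mem_nhdsWithin] with x hx
    simp [hg0, div_eq_inv_mul]
  have hHc0 : Tendsto Hc (𝓝[>] 0) (𝓝 (Hc 0)) := hHcc.continuousAt.tendsto.mono_left nhdsWithin_le_nhds
  have hm : Tendsto (fun x => x * f' x / f x) (𝓝[>] 0) (𝓝 ((Hc 0 - 1) / (a * Hc 0))) :=
    tendsto_logDeriv_of_profileEq Real.pi_pos ha hH0.ne' (fun x _ => hEq x) (fun x hx => (hneg' x hx).ne)
      hg_slope hHc0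
  have hm1 : 1 ≤ (Hc 0 - 1) / (a * Hc 0) := by
    -- apply the growth lemma to `F = −f > 0`
    refine one_le_of_tendsto_logDeriv (F := fun y => -f y) (F' := fun y => -f' y) (L := L) Real.pi_pos
      (fun y _ => (hfd y).neg) (fun y hy => by simpa using hneg' y hy) (fun y hy => ?_) ?_
    · have := hb0 y ⟨hy.1.le, hy.2.le⟩
      have : -f y ≤ |f y| := neg_le_abs _
      linarith
    · refine hm.congr' ?_
      filter_upwards [Ioo_mem_nhdsGT Real.pi_pos] with y hy
      have hfy : f y ≠ 0 := (hneg' y hy).ne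
      field_simp
  have ha1 : a < 1 := by
    -- `(1 − a m) H₀ = 1` with `m ≥ 1`
    have hprod : a * ((Hc 0 - 1) / (a * Hc 0)) = 1 - 1 / Hc 0 := by field_simp
    have hlt : a * ((Hc 0 - 1) / (a * Hc 0)) < 1 := by
      rw [hprod]; have := one_div_pos.mpr hH0; linarith
    rcases le_or_gt a 0 with ha0 | ha0
    · linarith
    · nlinarith
  -- ANTIPODE: shifted objects
  have hFpos : ∀ y ∈ Ioo (0 : ℝ) π, 0 < f (π + y) := by
    intro y hy
    have h1 : f (π + y) = -f (π - y) := by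
      have := hfper (-(π - y)); rw [show -(π - y) + 2 * π = π + y by ring, hfodd] at this; exact this
    rw [h1, neg_pos]
    exact hneg' (π - y) ⟨by linarith [hy.2], by linarith [hy.1]⟩
  have hG_slope : Tendsto (fun y => g (π + y) / y) (𝓝[>] 0) (𝓝 (Hc π)) := by
    have h := (hgd π).tendsto_slope_zero_right
    refine h.congr' ?_
    filter_upwards [self_mem_nhdsWithin] with y hy
    simp [hgπ, div_eq_inv_mul]
  have hHcπ : Tendsto (fun y => Hc (π + y)) (𝓝[>] 0) (𝓝 (Hc π)) := by
    have h1 : Tendsto (fun y : ℝ => π + y) (𝓝[>] 0) (𝓝 π) := by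
      have : Tendsto (fun y : ℝ => π + y) (𝓝 0) (𝓝 (π + 0)) := (continuous_const.add continuous_id).tendsto 0
      rw [add_zero] at this
      exact this.mono_left nhdsWithin_le_nhds
    exact (hHcc.tendsto π).comp h1
  have hp : Tendsto (fun y => y * f' (π + y) / f (π + y)) (𝓝[>] 0) (𝓝 ((Hc π - 1) / (a * Hc π))) :=
    tendsto_logDeriv_of_profileEq (f := fun y => f (π + y)) (g := fun y => g (π + y)) (h := fun y => Hc (π + y))
      Real.pi_pos ha hHπ.ne (fun y _ => hEq (π + y)) (fun y hy => (hFpos y hy).ne') hG_slope hHcπ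
  -- the antipodal order pins the limit to `P`
  obtain ⟨κ, hκ0, hκ⟩ := hP
  have hκ' : Tendsto (fun y => f (π + y) / y ^ P) (𝓝[>] 0) (𝓝 κ) := hκ.mono_left (nhdsGT_le_nhdsNE 0)
  have hpP : (Hc π - 1) / (a * Hc π) = P :=
    eq_natCast_of_tendsto_logDeriv (F := fun y => f (π + y)) (F' := fun y => f' (π + y)) Real.pi_pos
      (fun y _ => (hfd (π + y)).comp_const_add π y) hFpos hp hκ' hκ0
  have hanti : (1 - a * P) * Hc π = 1 := by
    have hHπne : Hc π ≠ 0 := hHπ.ne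
    rw [← hpP]
    field_simp
    ring
  have hneg1 : 1 - a * P < 0 := by
    by_contra h; push Not at h
    have : (1 - a * P) * Hc π ≤ 0 := mul_nonpos_of_nonneg_of_nonpos h hHπ.le
    linarith
  have hPpos : 0 < P := by
    rcases Nat.eq_zero_or_pos P with h | h
    · exfalso; rw [h] at hneg1; simp at hneg1; linarith
    · exact h
  have hP0 : (0 : ℝ) < P := by exact_mod_cast hPpos
  have haP : 1 / (P : ℝ) < a := by
    rw [div_lt_iff₀ hP0]; linarith
  have hP2 : 2 ≤ P := by
    have hapos : 0 < a := by
      by_contra h; push Not at h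
      have : a * P ≤ 0 := mul_nonpos_of_nonpos_of_nonneg h hP0.le
      linarith
    by_contra h; push Not at h
    have hP1 : (P : ℝ) ≤ 1 := by exact_mod_cast Nat.lt_succ_iff.mp h
    have : a * P ≤ a * 1 := mul_le_mul_of_nonneg_left hP1 hapos.le
    linarith
  -- ORIGIN IDENTITY for a simple zero: `x f′/f → f′(0)/f′(0) = 1`, so `m = 1` and `(1 − a)·H₀ = 1`
  have horigin : f' 0 ≠ 0 → (1 - a) * Hc 0 = 1 := by
    intro h0
    have hslope : Tendsto (fun x => f x / x) (𝓝[>] 0) (𝓝 (f' 0)) := by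
      have h := (hfd 0).tendsto_slope_zero_right
      refine h.congr' ?_
      filter_upwards [self_mem_nhdsWithin] with x hx
      simp [hf0, div_eq_inv_mul]
    have hf'c : Tendsto f' (𝓝[>] 0) (𝓝 (f' 0)) :=
      ((Complex.continuous_re.comp (continuous_fourierEval (expDecay_derivCoeff hdec))).tendsto 0).mono_left
        nhdsWithin_le_nhds
    have h1 : Tendsto (fun x => x * f' x / f x) (𝓝[>] 0) (𝓝 (f' 0 / f' 0)) := by
      refine (hf'c.div hslope h0).congr' ?_
      filter_upwards [Ioo_mem_nhdsGT Real.pi_pos] with x hx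
      rw [Pi.div_apply, div_div_eq_mul_div, mul_comm (f' x) x]
    rw [div_self h0] at h1
    have hm_eq : (Hc 0 - 1) / (a * Hc 0) = 1 := tendsto_nhds_unique hm h1
    have hH0ne : Hc 0 ≠ 0 := hH0.ne'
    field_simp at hm_eq
    linear_combination hm_eq
  refine ⟨⟨haP, ha1⟩, ?_, hP2, ?_⟩
  · rw [hH]
    exact hanti
  · rw [hH]
    exact horigin

/-- **E2 for the typed target: `1/P < a < 1`.** [folklore] -/
theorem apriori_window {a : ℝ} {c : ℤ → ℂ} {ρ K : ℝ} {P : ℕ} (hdec : ExpDecay c ρ K)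
    (hre : IsRealSeq c) (hodd : IsOddSeq c) (hneg : ∀ x : ℝ, 0 < x → x < π → (fourierEval c x).re < 0)
    (hT1 : IsSeparableProfile a c) (hP : HasAntipodalOrder c P) : 1 / (P : ℝ) < a ∧ a < 1 :=
  (apriori_window_and_antipode_identity hdec hre hodd hneg hT1 hP).1

/-- **Antipode identity for the typed target:** `(1 − a·P)·Hf(π) = 1`, i.e. `Hf(π) = −1/(aP − 1)` — a number every certified rung
must reproduce (`H = hilbertTransformCircle`, the analytic operator). [folklore] -/
theorem antipode_identity {a : ℝ} {c : ℤ → ℂ} {ρ K : ℝ} {P : ℕ} (hdec : ExpDecay c ρ K)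
    (hre : IsRealSeq c) (hodd : IsOddSeq c) (hneg : ∀ x : ℝ, 0 < x → x < π → (fourierEval c x).re < 0)
    (hT1 : IsSeparableProfile a c) (hP : HasAntipodalOrder c P) :
    (1 - a * P) * hilbertTransformCircle (fun y => (fourierEval c y).re) π = 1 :=
  (apriori_window_and_antipode_identity hdec hre hodd hneg hT1 hP).2.1

/-- **Origin identity for a simple zero:** if the profile has a simple zero at the origin (`f′(0) ≠ 0`, the case of every rung
numerically observed in [LushnikovSilantyevSiegel2021, §11]: negative slope at `0`), then `(1 − a)·Hf(0) = 1`, i.e. `Hf(0) = 1/(1 − a)`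
(`H = hilbertTransformCircle`). [folklore] -/
theorem origin_identity_of_simple_zero {a : ℝ} {c : ℤ → ℂ} {ρ K : ℝ} {P : ℕ} (hdec : ExpDecay c ρ K)
    (hre : IsRealSeq c) (hodd : IsOddSeq c) (hneg : ∀ x : ℝ, 0 < x → x < π → (fourierEval c x).re < 0)
    (hT1 : IsSeparableProfile a c) (hP : HasAntipodalOrder c P) (h0 : (fourierEval (derivCoeff c) 0).re ≠ 0) :
    (1 - a) * hilbertTransformCircle (fun y => (fourierEval c y).re) 0 = 1 :=
  (apriori_window_and_antipode_identity hdec hre hodd hneg hT1 hP).2.2.2 h0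

/-- The antipodal order of an analytic separable profile is at least `2` (`1/P < a < 1` forces `P > 1`). [folklore] -/
theorem two_le_antipodalOrder {a : ℝ} {c : ℤ → ℂ} {ρ K : ℝ} {P : ℕ} (hdec : ExpDecay c ρ K)
    (hre : IsRealSeq c) (hodd : IsOddSeq c) (hneg : ∀ x : ℝ, 0 < x → x < π → (fourierEval c x).re < 0)
    (hT1 : IsSeparableProfile a c) (hP : HasAntipodalOrder c P) : 2 ≤ P :=
  (apriori_window_and_antipode_identity hdec hre hodd hneg hT1 hP).2.2.1

/-- **The typed target, sharpened:** the parameter window of `AnalyticSeparableProfile P lo hi` may always be intersected with E2's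
a-priori interval `(1/P, 1)`. [folklore] -/
theorem analyticSeparableProfile_sharpen {P : ℕ} {lo hi : ℝ} (hA : AnalyticSeparableProfile P lo hi) :
    AnalyticSeparableProfile P (max lo (1 / (P : ℝ))) (min hi 1) := by
  obtain ⟨a, hlo, hhi, c, ρ, K, hdec, hre, hodd, hneg, hT1, hP⟩ := hA
  obtain ⟨h1, h2⟩ := apriori_window hdec hre hodd hneg hT1 hP
  exact ⟨a, max_le hlo h1.le, le_min hhi h2.le, c, ρ, K, hdec, hre, hodd, hneg, hT1, hP⟩

/-- E2 on the typed target, existential form: some `a ∈ [lo, hi] ∩ (1/P, 1)` carries the profile; in particular `P ≥ 2`. [folklore] -/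
theorem apriori_window_of_analyticSeparableProfile {P : ℕ} {lo hi : ℝ} (hA : AnalyticSeparableProfile P lo hi) :
    (∃ a : ℝ, lo ≤ a ∧ a ≤ hi ∧ 1 / (P : ℝ) < a ∧ a < 1) ∧ 2 ≤ P := by
  obtain ⟨a, hlo, hhi, c, ρ, K, hdec, hre, hodd, hneg, hT1, hP⟩ := hA
  obtain ⟨h1, h2⟩ := apriori_window hdec hre hodd hneg hT1 hP
  exact ⟨⟨a, hlo, hhi, h1, h2⟩, two_le_antipodalOrder hdec hre hodd hneg hT1 hP⟩

/-- No analytic separable profile in a parameter window lying at or below `1/P`. [folklore] -/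
theorem not_analyticSeparableProfile_of_hi_le {P : ℕ} {lo hi : ℝ} (h : hi ≤ 1 / (P : ℝ)) :
    ¬ AnalyticSeparableProfile P lo hi := by
  intro hA
  obtain ⟨⟨a, _, hhi, h1, _⟩, _⟩ := apriori_window_of_analyticSeparableProfile hA
  linarith

/-- No analytic separable profile in a parameter window lying at or above `1` (in particular none at De Gregorio's `a = 1`). [folklore] -/
theorem not_analyticSeparableProfile_of_one_le_lo {P : ℕ} {lo hi : ℝ} (h : 1 ≤ lo) :
    ¬ AnalyticSeparableProfile P lo hi := by
  intro hA
  obtain ⟨⟨a, hlo, _, _, h2⟩, _⟩ := apriori_window_of_analyticSeparableProfile hA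
  linarith

/-- No analytic separable profile with a SIMPLE antipodal zero (`P = 1`), for any parameter. [folklore] -/
theorem not_analyticSeparableProfile_one (lo hi : ℝ) : ¬ AnalyticSeparableProfile 1 lo hi := by
  intro hA
  have := (apriori_window_of_analyticSeparableProfile hA).2
  omega

/-- Consistency with the cell's `P = 3` instance: `AnalyticSeparableProfileA3`'s window `[0.755272287, 0.755272288]` already lies inside
`(1/3, 1)`, so sharpening changes nothing there; conversely E2 alone confines any `P = 3` profile to `a ∈ (1/3, 1)`. [folklore] -/
theorem analyticSeparableProfile_three_window {lo hi : ℝ} (hA : AnalyticSeparableProfile 3 lo hi) :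
    ∃ a : ℝ, lo ≤ a ∧ a ≤ hi ∧ 1 / 3 < a ∧ a < 1 := by
  obtain ⟨⟨a, hlo, hhi, h1, h2⟩, _⟩ := apriori_window_of_analyticSeparableProfile hA
  exact ⟨a, hlo, hhi, by norm_num at h1; linarith, h2⟩

end OSWAprioriWindow
end Summit.NavierStokesRegularity.OSWSelfSimilar

end
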